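import Mathlib
import HarnessLib
import Summits.Parity.Statement
import Summits.Parity.GeneralizedHardyLittlewood.Theses.BarrierZoneCarving

/-!
# Assembly of route-Parity-BarrierZoneCarving (item stmt-Parity-23691)

`Assembly : MobiusDilationBelowHalf → FactorableWindow → RoughWindow → PrimeSideLevelHalf → Spine → PairsToGHL → GeneralizedHardyLittlewood` is literally the route's certified deciding theorem `closes`
(lens-6 g1 node «BarrierZoneCarving» (rev 0)): the three carved windows + prime-side level ½ + the spine give prime pairs, and `PairsToGHL` lifts.  One line; no mathematics beyond the route file.
-/

namespace Summit.Parity.GeneralizedHardyLittlewood.Theses.BarrierZoneCarving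

/-- Assembly item stmt-Parity-23691 of route-Parity-BarrierZoneCarving:
`MobiusDilationBelowHalf → FactorableWindow → RoughWindow → PrimeSideLevelHalf → Spine → PairsToGHL → GeneralizedHardyLittlewood`,
by the route's deciding theorem `closes`. -/
theorem assembly_proof : Assembly :=
  fun h1 h2 h3 h4 h5 h6 => closes h1 h2 h3 h4 h5 h6

end Summit.Parity.GeneralizedHardyLittlewood.Theses.BarrierZoneCarving
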